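import Mathlib
import HarnessLib
import Literature.MathematicalPhysics.QuantumFieldTheory.WilsonPlaquetteWeakCouplingFloor
import Summits.Ventures.LatticeQCDFlow.Scaling.AutoregressiveGaugePlaquetteMarginal
import Summits.Ventures.LatticeQCDFlow.Scaling.AutoregressiveGaugeBlindProposal
import Summits.Ventures.LatticeQCDFlow.Scaling.TorusPlaquetteGeometry

/-!
# LatticeQCDFlow / Scaling — a VOLUME-UNIFORM NUMBER: the exact conditional of a gauge link given one
# staple is, on average, at total-variation distance ≥ ½(1 − 8r²/N + 2 log φ_ρ(r)/((d−1)Nβ)) from Haar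

HONEST FRAMING: exact (Metropolis-corrected) sampling algorithms for lattice gauge theory;
figures of merit are autocorrelation/cost numbers at stated couplings and volumes; no
continuum-physics claim.

Venture `LatticeQCDFlow` (cell pub-lqcd), topic `Scaling`, FANOUT row 30 (lean-1, GEN-18) — OUR WORK for
THEORY-2 §4 row C5 (gauge case), the quantitative corollary of `Scaling/AutoregressiveGaugePlaquetteMarginal`:
there, for every compact `G`, continuous unitary-type `ρ` with a non-trivial central scalar, every `d`, `L ≥ 2`,
`β`: `∫ Re tr ρ(U_p) e^{−βS_W} ≤ N·∫ |A_s F − A_{insert e₁ s} F|` (`s` = links off the plaquette `p`,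
`e₁` its closing link, `F = e^{−βS_W}`), and `∫ |A_s F − A_{insert e₁ s} F| / Z` is twice the
Wilson-measure average of the total-variation distance between the exact conditional law of `U_{e₁}` given
the staple and the Haar prior.  The tree's volume-uniform weak-coupling floor
(`Literature/…/WilsonPlaquetteWeakCouplingFloor.wilsonExpectation_plaquette_ge_linkBall`:
`⟨(1/N) Re tr ρ(U_p)⟩_β ≥ 1 − 8r²/N + 2 log φ_ρ(r)/((d−1)Nβ)`, `φ_ρ(r) = Haar{‖ρ(g) − 1‖_F ≤ r}`) turns it
into a NUMBER:

* **`wilson_plaquetteMarginal_tv_ge_linkBall`** — for unitary `ρ` (`N ≥ 1`) with a central `z`, `ρ z = ω·1`,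
  `ω ≠ 1`, every `d ≥ 2`, `L ≥ 2`, `β > 0`, `r > 0`, every plaquette `p`:
  `Z · (1 − 8r²/N + 2 log φ_ρ(r)/((d−1)Nβ)) ≤ ∫ |A_s F − A_{insert e₁ s} F| dHaar^{⊗E}`, `Z = ∫ F`.
* **`wilson_stapleBlindProposal_tv_ge_linkBall`** — the same floor for `∫ |A_s F − q·A_{insert e₁ s} F|` for EVERY
  bounded measurable proposal density `q` for the closing link that is blind to the staple link `(x+e_k, l)`
  (and normalised in the `e₁` coordinate): by `Scaling/AutoregressiveGaugeBlindProposal` the Haar prior is the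
  best such proposal.

READING (value-free): the average total-variation distance between the exact one-staple conditional of a
link and Haar is at least `½(1 − 8r²/N + 2 log φ_ρ(r)/((d−1)Nβ))` for every `r > 0`, UNIFORMLY IN THE
VOLUME — it tends to `½` as `β → ∞` (`r → 0` after `β → ∞`): at weak coupling an exact autoregressive
conditioner for a gauge link must move at least half the mass away from the prior given a single staple,
in every dimension and for every such gauge group (`SU(3)`, `d = 4` included).  NOT CLAIMED: the
strong-coupling regime beyond positivity; optimal constants; any number of ours beyond the tree's floor.
Elementary over the parents; no `def`; nothing is cited as a fact beyond the tree; no `sorry`.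
-/

noncomputable section

namespace Summit.Ventures.LatticeQCDFlow.Theory2.Autoregressive

open MeasureTheory Function Set
open Literature.MathematicalPhysics.QuantumFieldTheory Literature.MathematicalPhysics.QuantumLattice
open Summit.Ventures.LatticeQCDFlow.Exactness
open scoped Matrix Matrix.Norms.Frobenius
open Summit.Ventures.LatticeQCDFlow.Theory2.Lattice.TorusGeom (single_inj)

variable {d L N : ℕ} {G : Type*} [Group G] [TopologicalSpace G] [IsTopologicalGroup G]
  [CompactSpace G] [SecondCountableTopology G] [MeasurableSpace G] [BorelSpace G] [NeZero L]
  (ρ : G →* Matrix (Fin N) (Fin N) ℂ)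

/-- **THE VOLUME-UNIFORM TOTAL-VARIATION FLOOR**: `Z·(1 − 8r²/N + 2 log φ_ρ(r)/((d−1)Nβ)) ≤
∫ |A_s F − A_{insert e₁ s} F| dHaar^{⊗E}` for the links `s` off a plaquette and its closing link `e₁`
(unitary `ρ`, `N ≥ 1`, central `z` with `ρ z = ω·1`, `ω ≠ 1`; `d ≥ 2`, `L ≥ 2`, `β > 0`, `r > 0`).
[ours] -/
theorem wilson_plaquetteMarginal_tv_ge_linkBall (hd : 2 ≤ d) (hN : 1 ≤ N) (hρ : Continuous ρ)
    (hρU : ∀ g, ρ g ∈ Matrix.unitaryGroup (Fin N) ℂ) (hL : 2 ≤ L)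
    {z : G} {ω : ℂ} (hω : ρ z = ω • (1 : Matrix (Fin N) (Fin N) ℂ)) (hne : ω ≠ 1)
    {β : ℝ} (hβ : 0 < β) {r : ℝ} (hr : 0 < r) (p : Plaquette d L) :
    (∫ U, Real.exp (-β * wilsonAction ρ U) ∂Measure.pi (fun _ : Edge d L => haarProbability G)) *
        (1 - 8 * r ^ 2 / N +
          2 * Real.log ((haarProbability G).real {g : G | ‖ρ g - 1‖ ≤ r}) / (((d : ℝ) - 1) * N * β)) ≤
      ∫ U, |coordAvg (haarProbability G)
            (Finset.univ \ {(p.1, p.2.1.1), (p.1.shift p.2.1.1, p.2.1.2), (p.1.shift p.2.1.2, p.2.1.1), (p.1, p.2.1.2)})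
            (fun V : GaugeConfig d L G => Real.exp (-β * wilsonAction ρ V)) U -
          coordAvg (haarProbability G)
            (insert (p.1, p.2.1.1)
              (Finset.univ \ {(p.1, p.2.1.1), (p.1.shift p.2.1.1, p.2.1.2), (p.1.shift p.2.1.2, p.2.1.1), (p.1, p.2.1.2)}))
            (fun V : GaugeConfig d L G => Real.exp (-β * wilsonAction ρ V)) U|
        ∂Measure.pi (fun _ : Edge d L => haarProbability G) := by
  set π := Measure.pi (fun _ : Edge d L => haarProbability G) with hπ
  set Z := ∫ U, Real.exp (-β * wilsonAction ρ U) ∂π with hZ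
  have hZpos : 0 < Z :=
    integral_exp_pos (Literature.Probability.LatticeModels.integrable_of_continuous_compactSpace _
      (Real.continuous_exp.comp (continuous_const.mul (continuous_wilsonAction ρ hρ))))
  -- the floor on the normalised plaquette mean
  have hfloor := wilsonExpectation_plaquette_ge_linkBall (d := d) (L := L) ρ hd hN hρ hρU hβ hr p.1
    (ne_of_lt p.2.2)
  -- `⟨(1/N) Re tr U_p⟩ = N⁻¹·(∫ Re tr(U_p) F)/Z`
  rw [wilsonExpectation_eq_integral_div ρ hρ] at hfloor
  have hnum : ∫ U, (N : ℝ)⁻¹ * (ρ (plaquetteHolonomy U p.1 p.2.1.1 p.2.1.2)).trace.re *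
        Real.exp (-β * wilsonAction ρ U) ∂π =
      (N : ℝ)⁻¹ * ∫ U, (ρ (plaquetteHolonomy U p.1 p.2.1.1 p.2.1.2)).trace.re *
        Real.exp (-β * wilsonAction ρ U) ∂π := by
    rw [← integral_const_mul]
    refine integral_congr_ae (ae_of_all _ fun U => ?_)
    ring
  rw [hnum] at hfloor
  -- the TV bound of the parent
  have htv := wilson_plaquetteMarginal_tv_lower_bound (d := d) (L := L) ρ hρ hL hω hne β p
  have hNpos : (0 : ℝ) < N := by exact_mod_cast hN
  -- combine: `floor ≤ N⁻¹ X / Z` and `X ≤ N · I` give `Z · floor ≤ I`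
  have h1 : (1 - 8 * r ^ 2 / N +
      2 * Real.log ((haarProbability G).real {g : G | ‖ρ g - 1‖ ≤ r}) / (((d : ℝ) - 1) * N * β)) * Z ≤
      (N : ℝ)⁻¹ * ∫ U, (ρ (plaquetteHolonomy U p.1 p.2.1.1 p.2.1.2)).trace.re *
        Real.exp (-β * wilsonAction ρ U) ∂π := (le_div_iff₀ hZpos).1 hfloor
  have h2 : (N : ℝ)⁻¹ * ∫ U, (ρ (plaquetteHolonomy U p.1 p.2.1.1 p.2.1.2)).trace.re *
        Real.exp (-β * wilsonAction ρ U) ∂π ≤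
      ∫ U, |coordAvg (haarProbability G)
            (Finset.univ \ {(p.1, p.2.1.1), (p.1.shift p.2.1.1, p.2.1.2), (p.1.shift p.2.1.2, p.2.1.1), (p.1, p.2.1.2)})
            (fun V : GaugeConfig d L G => Real.exp (-β * wilsonAction ρ V)) U -
          coordAvg (haarProbability G)
            (insert (p.1, p.2.1.1)
              (Finset.univ \ {(p.1, p.2.1.1), (p.1.shift p.2.1.1, p.2.1.2), (p.1.shift p.2.1.2, p.2.1.1), (p.1, p.2.1.2)}))
            (fun V : GaugeConfig d L G => Real.exp (-β * wilsonAction ρ V)) U| ∂π := by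
    rw [inv_mul_le_iff₀ hNpos]
    exact htv
  rw [mul_comm]
  exact h1.trans h2

/-- **THE SAME FLOOR FOR EVERY STAPLE-BLIND PROPOSAL**: if a bounded measurable proposal density `q` for the
closing link `e₁ = (x, k)` ignores the staple link `e₂ = (x+e_k, l)` (it may read every other link) and is
normalised in the `e₁` coordinate, then `Z·(1 − 8r²/N + 2 log φ_ρ(r)/((d−1)Nβ)) ≤ ∫ |A_s F − q·A_{insert e₁ s} F|`
— in the Wilson-measure average its total-variation distance to the exact conditional is at least half the
weak-coupling plaquette floor, uniformly in the volume (Haar is the best blind proposal,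
`Scaling/AutoregressiveGaugeBlindProposal`). [ours] -/
theorem wilson_stapleBlindProposal_tv_ge_linkBall (hd : 2 ≤ d) (hN : 1 ≤ N) (hρ : Continuous ρ)
    (hρU : ∀ g, ρ g ∈ Matrix.unitaryGroup (Fin N) ℂ) (hL : 2 ≤ L)
    {z : G} {ω : ℂ} (hω : ρ z = ω • (1 : Matrix (Fin N) (Fin N) ℂ)) (hne : ω ≠ 1)
    {β : ℝ} (hβ : 0 < β) {r : ℝ} (hr : 0 < r) (p : Plaquette d L)
    {q : GaugeConfig d L G → ℝ} (hqm : Measurable q) (hqb : ∃ C, ∀ U, |q U| ≤ C)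
    (hq₂ : ∀ U v, q (update U (p.1.shift p.2.1.1, p.2.1.2) v) = q U)
    (hq1 : ∀ U, ∫ v, q (update U (p.1, p.2.1.1) v) ∂(haarProbability G) = 1) :
    (∫ U, Real.exp (-β * wilsonAction ρ U) ∂Measure.pi (fun _ : Edge d L => haarProbability G)) *
        (1 - 8 * r ^ 2 / N +
          2 * Real.log ((haarProbability G).real {g : G | ‖ρ g - 1‖ ≤ r}) / (((d : ℝ) - 1) * N * β)) ≤
      ∫ U, |coordAvg (haarProbability G)
            (Finset.univ \ {(p.1, p.2.1.1), (p.1.shift p.2.1.1, p.2.1.2), (p.1.shift p.2.1.2, p.2.1.1), (p.1, p.2.1.2)})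
            (fun V : GaugeConfig d L G => Real.exp (-β * wilsonAction ρ V)) U -
          q U * coordAvg (haarProbability G)
            (insert (p.1, p.2.1.1)
              (Finset.univ \ {(p.1, p.2.1.1), (p.1.shift p.2.1.1, p.2.1.2), (p.1.shift p.2.1.2, p.2.1.1), (p.1, p.2.1.2)}))
            (fun V : GaugeConfig d L G => Real.exp (-β * wilsonAction ρ V)) U|
        ∂Measure.pi (fun _ : Edge d L => haarProbability G) := by
  classical
  refine (wilson_plaquetteMarginal_tv_ge_linkBall ρ hd hN hρ hρU hL hω hne hβ hr p).trans ?_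
  -- the corner `x + e_k`: `e₁` arrives, `e₂` leaves, the other links there are integrated
  set x := p.1 with hx
  set k := p.2.1.1 with hk
  set l := p.2.1.2 with hl
  have hkl : k ≠ l := ne_of_lt p.2.2
  set s : Finset (Edge d L) := Finset.univ \ {(x, k), (x.shift k, l), (x.shift l, k), (x, l)} with hs
  obtain ⟨hFm, B, hFlo, hFhi⟩ := wilsonWeight_props (d := d) (L := L) ρ hρ β
  have hFb : ∃ C, ∀ U : GaugeConfig d L G, |Real.exp (-β * wilsonAction ρ U)| ≤ C :=
    ⟨Real.exp (|β| * B), fun U => by rw [abs_of_pos (Real.exp_pos _)]; exact hFhi U⟩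
  have hek : ∀ y : Site d L, y.shift k ≠ y := fun y =>
    Summit.Ventures.LatticeQCDFlow.Theory2.Autoregressive.site_shift_ne hL y k
  have hel : ∀ y : Site d L, y.shift l ≠ y := fun y => site_shift_ne hL y l
  have hkl' : x.shift k ≠ x.shift l := fun h => hkl (single_inj hL (add_left_cancel h))
  have hcomm : (x.shift k).shift l = (x.shift l).shift k := by
    simp only [Site.shift]; exact add_right_comm _ _ _
  have hmem_s : ∀ e : Edge d L, e ∈ s ↔ e ≠ (x, k) ∧ e ≠ (x.shift k, l) ∧ e ≠ (x.shift l, k) ∧ e ≠ (x, l) := by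
    intro e; simp [hs]
  have hstar : ∀ e : Edge d L, e.1 = x.shift k ∨ e.1.shift e.2 = x.shift k → e ≠ (x, k) →
      e ≠ (x.shift k, l) → e ∈ s := by
    intro e he hn1 hn2
    rw [hmem_s]
    refine ⟨hn1, hn2, fun h => ?_, fun h => ?_⟩ <;> subst h
    · rcases he with h | h
      · exact hkl'.symm h
      · exact hel (x.shift k) (by rw [hcomm]; exact h)
    · rcases he with h | h
      · exact (hek x).symm h
      · exact hkl'.symm h
  exact integral_abs_sub_le_of_blindProposal s (isGaugeInvariant_wilsonWeightFun ρ β) hFm hFb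
    (y := x.shift k) (ℓ₁ := (x, k)) (ℓ₂ := (x.shift k, l)) (fun h => (hek x).symm (congrArg Prod.fst h)) rfl
    (hek x).symm rfl (hel (x.shift k)) hstar hqm hqb hq₂ hq1

end Summit.Ventures.LatticeQCDFlow.Theory2.Autoregressive

end
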